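import Literature.NumberTheory.Irrationality.Fischler2002.Theoreme32FiveProofs
import Literature.NumberTheory.Irrationality.Fischler2002.Theoreme32TwoProofs
import Literature.NumberTheory.Irrationality.Fischler2002.Theoreme32RouteFourProofs
import HarnessLib

/-!
# Fischler 2002, Théorème 3.2 — brick XIII: the Rhin–Viola clause and the invariance of `𝒥/N` for `n = 4`; all `n ≠ 3`

Topic `Literature/NumberTheory/Irrationality/Fischler2002`. PROOFS ONLY (no definition, no statement, no discharge of the `∀ n ≥ 2` fact):
for `n = 4` the two last clauses of the typed `theoreme32` HOLD (`invariance_four`, `isRhinViolaGroup_four`, hence `theoreme32_four`: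
« pour `n ≥ 4` … il laisse stable `𝒥(p)/(a₃! b₃! a₂!)` si `n = 4` » [Fischler2002Polyzetas, §3 Th. 3.2]); with bricks IX and XI this gives
Théorème 3.2 for EVERY `n ≥ 2` EXCEPT `n = 3` (`theoreme32_of_ne_three`). For `n = 4` the second orbit of linear forms has NINE elements
`u₀ = −a₁+a₃+a₄, u₁ = a₁+b₂−b₄, u₂ = a₁+a₂−b₄, u₃ = −a₁+a₂+b₃, u₄ = −a₁+a₃+b₄, u₅ = b₃, u₆ = a₁−a₄+b₂, u₇ = a₁+a₂−a₃, u₈ = a₁+a₂−a₄`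
(rank 5), permuted through `σ ↦ (0 2)(3 7)(4 8)`, `ψ ↦ (0 8)(1 7)(3 6)`, `φ ↦ (0 3)(1 5)(2 7)`; in the cone `a_k ≥ 0, b₂, b₄ ≥ 0` the criterion
is `b₃ ≥ 0`, fourteen pairs of forms cannot be simultaneously negative (`forbidden_pairs`), and brick XII's kernel-checked routing over the
27 admissible sign patterns supplies the criterion path; faithfulness (brick IV) and `transport` (brick V) finish. The case `n = 3` is NOT
a transport statement (seat ct-1 g33's recon memo §5) and stays open. Cell `pub-zeta5`, seat ct-1 g33, 2026-08-28.
[cite: Fischler2002Polyzetas, §3 Théorème 3.2] [cite: Fischler2003RhinViola, §3.3 Théorème 5, §3.4 Théorème 6]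

HONEST FRAMING (cell pub-zeta5): systematic search; no irrationality claim unless certified — identities between (possibly infinite) integrals of
non-negative functions and finite bookkeeping; nothing about `ζ(5)`.
-/

noncomputable section

namespace Literature.NumberTheory.Irrationality.Fischler2002

namespace Theoreme32

open Equiv
open scoped ENNReal

section Four

variable {f : Fin 6 → Exponents → ℤ} {U : Fin 9 → Exponents → ℤ}
  (hf : ∀ (x : Fin 6) (p : Exponents), f x p = ![p.a 1, p.a 2, p.b 2, p.a 4, p.a (4 - 1), p.c 4] x)
  (hU : ∀ (x : Fin 9) (p : Exponents), U x p = ![-p.a 1 + p.a 3 + p.a 4, p.a 1 + p.b 2 - p.b 4, p.a 1 + p.a 2 - p.b 4,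
    -p.a 1 + p.a 2 + p.b 3, -p.a 1 + p.a 3 + p.b 4, p.b 3, p.a 1 - p.a 4 + p.b 2, p.a 1 + p.a 2 - p.a 3, p.a 1 + p.a 2 - p.a 4] x)
  {gσ gψ gφ : Perm {p : Exponents // InE 4 p}}

/-! ### The nine forms and the action of the generators (`n = 4`) -/

include hU in
/-- `σ` acts on the nine forms through `(0 2)(3 7)(4 8)`. [cite: Fischler2002Polyzetas, §3 Théorème 3.2 (n = 4)] -/
theorem rel9_sigma (hσ : ∀ p, (gσ p).1 = sigma p.1) (x : Fin 9) (p : {p : Exponents // InE 4 p}) :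
    U x (gσ p).1 = U ((swap (0 : Fin 9) 2 * swap (3 : Fin 9) 7 * swap (4 : Fin 9) 8) x) p.1 := by
  obtain ⟨-, -, h4⟩ := p.2
  obtain ⟨h21, hbn, hch⟩ := h4 le_rfl
  have c1 := hch 1 le_rfl (by norm_num)
  have c2 := hch 2 (by norm_num) (by norm_num)
  norm_num at c1 c2
  rw [hσ p]
  fin_cases x <;> simp [hU, sigma, Equiv.swap_apply_def] <;> linarith

include hU in
/-- `ψ` acts on the nine forms through `(0 8)(1 7)(3 6)`. [cite: Fischler2002Polyzetas, §3 Théorème 3.2 (n = 4)] -/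
theorem rel9_psi (hψ : ∀ p, (gψ p).1 = psi 4 p.1) (x : Fin 9) (p : {p : Exponents // InE 4 p}) :
    U x (gψ p).1 = U ((swap (0 : Fin 9) 8 * swap (1 : Fin 9) 7 * swap (3 : Fin 9) 6) x) p.1 := by
  obtain ⟨hc, -, h4⟩ := p.2
  obtain ⟨h21, hbn, hch⟩ := h4 le_rfl
  have c1 := hch 1 le_rfl (by norm_num)
  have c2 := hch 2 (by norm_num) (by norm_num)
  norm_num at c1 c2
  rw [hψ p]
  fin_cases x <;> simp [hU, psi, Equiv.swap_apply_def] <;> linarith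

include hU in
/-- `φ` acts on the nine forms through `(0 3)(1 5)(2 7)`. [cite: Fischler2002Polyzetas, §3 Théorème 3.2 (n = 4)] -/
theorem rel9_phi (hφ : ∀ p, (gφ p).1 = phi 4 p.1) (x : Fin 9) (p : {p : Exponents // InE 4 p}) :
    U x (gφ p).1 = U ((swap (0 : Fin 9) 3 * swap (1 : Fin 9) 5 * swap (2 : Fin 9) 7) x) p.1 := by
  obtain ⟨-, -, h4⟩ := p.2
  obtain ⟨h21, hbn, hch⟩ := h4 le_rfl
  have c1 := hch 1 le_rfl (by norm_num)
  have c2 := hch 2 (by norm_num) (by norm_num)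
  norm_num at c1 c2
  rw [hφ p]
  fin_cases x <;> simp [hU, phi, Equiv.swap_apply_def] <;> linarith

/-- Products for the nine-form relation. [cite: Fischler2002Polyzetas, §3 Théorème 3.2] -/
theorem rel9_mul {g h : Perm {p : Exponents // InE 4 p}} {π τ : Perm (Fin 9)}
    (hg : ∀ x p, U x (g p).1 = U (π x) p.1) (hh : ∀ x p, U x (h p).1 = U (τ x) p.1) :
    ∀ x p, U x ((g * h) p).1 = U ((τ * π) x) p.1 := by
  intro x p
  rw [Perm.mul_apply, hg, hh, Perm.mul_apply]

/-- Inverses for the nine-form relation. [cite: Fischler2002Polyzetas, §3 Théorème 3.2] -/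
theorem rel9_inv {g : Perm {p : Exponents // InE 4 p}} {π : Perm (Fin 9)} (hg : ∀ x p, U x (g p).1 = U (π x) p.1) :
    ∀ x p, U x (g⁻¹ p).1 = U (π⁻¹ x) p.1 := by
  intro x p
  have h := hg (π⁻¹ x) (g⁻¹ p)
  simp only [Perm.coe_inv, Equiv.apply_symm_apply] at h ⊢
  exact h.symm

/-! ### The cone `a_k ≥ 0, b₂ ≥ 0, b₄ ≥ 0`, the criterion and the forbidden pairs (`n = 4`) -/

/-- Every element of `⟨σ', ψ', φ'⟩` (`n = 4`) maps the cone `{a_k ≥ 0 (1 ≤ k ≤ 4), b₂ ≥ 0, b₄ ≥ 0}` into itself.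
[cite: Fischler2002Polyzetas, §3 Théorème 3.2 (n = 4)] -/
theorem cone4_of_mem (hσ : ∀ p, (gσ p).1 = sigma p.1) (hψ : ∀ p, (gψ p).1 = psi 4 p.1) (hφ : ∀ p, (gφ p).1 = phi 4 p.1)
    {g : Perm {p : Exponents // InE 4 p}} (hg : g ∈ Subgroup.closure ({gσ, gψ, gφ} : Set (Perm {p : Exponents // InE 4 p}))) :
    ∀ p : {p : Exponents // InE 4 p},
      ((∀ k ∈ Finset.Icc 1 4, 0 ≤ p.1.a k) ∧ 0 ≤ p.1.b 2 ∧ 0 ≤ p.1.b 4) →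
      ((∀ k ∈ Finset.Icc 1 4, 0 ≤ (g p).1.a k) ∧ 0 ≤ (g p).1.b 2 ∧ 0 ≤ (g p).1.b 4) := by
  have hI : Finset.Icc 1 4 = {1, 2, 3, 4} := by decide
  have step : ∀ x ∈ ({gσ, gψ, gφ} : Set (Perm {p : Exponents // InE 4 p})), ∀ p : {p : Exponents // InE 4 p},
      ((∀ k ∈ Finset.Icc 1 4, 0 ≤ p.1.a k) ∧ 0 ≤ p.1.b 2 ∧ 0 ≤ p.1.b 4) →
      ((∀ k ∈ Finset.Icc 1 4, 0 ≤ (x p).1.a k) ∧ 0 ≤ (x p).1.b 2 ∧ 0 ≤ (x p).1.b 4) := by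
    intro x hx p ⟨ha, hb2, hb4⟩
    obtain ⟨-, -, h4⟩ := p.2
    obtain ⟨h21, hbn, -⟩ := h4 le_rfl
    simp only [hI, Finset.mem_insert, Finset.mem_singleton, forall_eq_or_imp, forall_eq] at ha ⊢
    obtain ⟨ha1, ha2, ha3, ha4⟩ := ha
    simp only [Set.mem_insert_iff, Set.mem_singleton_iff] at hx
    rcases hx with rfl | rfl | rfl
    · rw [hσ p]; simp [sigma]; exact ⟨⟨hb2, by linarith, ha3, ha4⟩, ha1, hb4⟩
    · rw [hψ p]; simp [psi]; exact ⟨⟨ha4, ha3, ha2, ha1⟩, hb4, hb2⟩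
    · rw [hφ p]; simp [phi]; exact ⟨⟨ha1, ha2, by linarith, ha4⟩, hb2, by linarith⟩
  have hinvs : ∀ x ∈ ({gσ, gψ, gφ} : Set (Perm {p : Exponents // InE 4 p})), x⁻¹ = x := by
    intro x hx
    simp only [Set.mem_insert_iff, Set.mem_singleton_iff] at hx
    rcases hx with rfl | rfl | rfl
    · exact inv_eq_of_mul_eq_one_right (perm_sigma_mul_self hσ)
    · exact inv_eq_of_mul_eq_one_right (perm_psi_mul_self (by norm_num) hψ)
    · exact inv_eq_of_mul_eq_one_right (perm_phi_mul_self (by norm_num) hφ)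
  induction hg using Subgroup.closure_induction_left with
  | one => intro p hp; simpa using hp
  | mul_left x hx y _ ih => intro p hp; rw [Perm.mul_apply]; exact step x hx _ (ih p hp)
  | inv_mul_cancel x hx y _ ih => intro p hp; rw [Perm.mul_apply, hinvs x hx]; exact step x hx _ (ih p hp)

/-- In the cone (`n = 4`, `p ∈ 𝓔`), Fischler's criterion is `b₃ ≥ 0`. [cite: Fischler2002Polyzetas, §3 p. 4 and Théorème 3.2] -/
theorem crit4_iff_of_cone {q : Exponents} (hq : InE 4 q) (hK : (∀ k ∈ Finset.Icc 1 4, 0 ≤ q.a k) ∧ 0 ≤ q.b 2 ∧ 0 ≤ q.b 4) :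
    FinitenessCriterionGen 4 q ↔ 0 ≤ q.b 3 := by
  obtain ⟨ha, hb2, hb4⟩ := hK
  obtain ⟨h21, -, -⟩ := hq.2.2 le_rfl
  rw [crit_iff_nonneg_of_InE le_rfl hq]
  have hI : Finset.Icc 1 4 = {1, 2, 3, 4} := by decide
  simp only [hI, Finset.mem_insert, Finset.mem_singleton, forall_eq_or_imp, forall_eq] at ha ⊢
  constructor
  · exact fun h => h.2.2.2.1
  · intro h3; exact ⟨ha, by rw [← h21]; exact ha.2.1, hb2, h3, hb4⟩

include hU in
/-- **The fourteen forbidden pairs**: in the cone `a_k ≥ 0, b₂ ≥ 0, b₄ ≥ 0` (`p ∈ 𝓔`), the pairs of forms `06, 07, 08, 13, 14, 17, 18, 23, 24, 26, 36, 38,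
47, 67` cannot be simultaneously negative (linear certificates from `b₃ = a₁+b₂−a₃`, `b₄ = a₂+b₃−a₄`).
[cite: Fischler2002Polyzetas, §3 Théorème 3.2 (n = 4)] -/
theorem forbidden_pairs (p : {p : Exponents // InE 4 p}) (hK : (∀ k ∈ Finset.Icc 1 4, 0 ≤ p.1.a k) ∧ 0 ≤ p.1.b 2 ∧ 0 ≤ p.1.b 4) :
    ∀ pr ∈ [((0 : Fin 9), (6 : Fin 9)), (0, 7), (0, 8), (1, 3), (1, 4), (1, 7), (1, 8), (2, 3), (2, 4), (2, 6), (3, 6), (3, 8), (4, 7),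
      (6, 7)], ¬ ((fun y => decide (U y p.1 < 0)) pr.1 = true ∧ (fun y => decide (U y p.1 < 0)) pr.2 = true) := by
  obtain ⟨ha, hb2, hb4⟩ := hK
  obtain ⟨-, -, h4⟩ := p.2
  obtain ⟨h21, hbn, hch⟩ := h4 le_rfl
  have c1 := hch 1 le_rfl (by norm_num)
  have c2 := hch 2 (by norm_num) (by norm_num)
  norm_num at c1 c2
  have hI : Finset.Icc 1 4 = {1, 2, 3, 4} := by decide
  simp only [hI, Finset.mem_insert, Finset.mem_singleton, forall_eq_or_imp, forall_eq] at ha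
  obtain ⟨ha1, ha2, ha3, ha4⟩ := ha
  intro pr hpr
  simp only [List.mem_cons, List.not_mem_nil, or_false] at hpr
  simp only [decide_eq_true_eq]
  rcases hpr with rfl | rfl | rfl | rfl | rfl | rfl | rfl | rfl | rfl | rfl | rfl | rfl | rfl | rfl <;>
    (rintro ⟨h1, h2⟩; simp [hU] at h1 h2; linarith)

/-! ### Words, faithfulness, and the assembly (`n = 4`) -/

include hf hU in
/-- **The joint relation along words (`n = 4`).** [cite: Fischler2002Polyzetas, §3 Théorème 3.2] -/
theorem word_rel4 (hσ : ∀ p, (gσ p).1 = sigma p.1) (hψ : ∀ p, (gψ p).1 = psi 4 p.1) (hφ : ∀ p, (gφ p).1 = phi 4 p.1)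
    (w : List ℕ) :
    ∃ π : Perm (Fin 6), ∃ τ : Perm (Fin 9),
      ((∀ x p, f x ((w.map fun m => if m = 0 then gσ else if m = 1 then gψ else gφ).prod p).1 = f (π x) p.1) ∧
        (∀ x : Fin 6, (π x).val < 3 ↔ (x.val < 3 ↔ (π 0).val < 3)) ∧
        ∀ (p : {p : Exponents // InE 4 p}) (k : ℕ), 3 ≤ k → k ≤ 4 - 2 →
          ((w.map fun m => if m = 0 then gσ else if m = 1 then gψ else gφ).prod p).1.a k =
            p.1.a (if 3 ≤ (π 0).val then 4 + 1 - k else k)) ∧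
      (∀ x p, U x ((w.map fun m => if m = 0 then gσ else if m = 1 then gψ else gφ).prod p).1 = U (τ x) p.1) ∧
      (w.map fun m : ℕ => if m = 0 then ((swap (0 : Fin 6) 2, swap (0 : Fin 9) 2 * swap (3 : Fin 9) 7 * swap (4 : Fin 9) 8) :
          Perm (Fin 6) × Perm (Fin 9))
        else if m = 1 then (swap (0 : Fin 6) 3 * swap (1 : Fin 6) 4 * swap (2 : Fin 6) 5,
          swap (0 : Fin 9) 8 * swap (1 : Fin 9) 7 * swap (3 : Fin 9) 6)
        else (swap (4 : Fin 6) 5, swap (0 : Fin 9) 3 * swap (1 : Fin 9) 5 * swap (2 : Fin 9) 7)).prod = (π⁻¹, τ⁻¹) := by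
  induction w with
  | nil =>
    refine ⟨1, 1, ⟨fun x p => rfl, fun x => by simp, fun p k hk3 hkn => by omega⟩, fun x p => rfl, by
      simp only [List.map_nil, List.prod_nil, inv_one]; rfl⟩
  | cons m w ih =>
    obtain ⟨π, τ, hrel, hu, hJ⟩ := ih
    have i1 : (swap (0 : Fin 9) 2 * swap (3 : Fin 9) 7 * swap (4 : Fin 9) 8)⁻¹ = swap (0 : Fin 9) 2 * swap (3 : Fin 9) 7 * swap (4 : Fin 9) 8 := by
      decide
    have i2 : (swap (0 : Fin 9) 8 * swap (1 : Fin 9) 7 * swap (3 : Fin 9) 6)⁻¹ = swap (0 : Fin 9) 8 * swap (1 : Fin 9) 7 * swap (3 : Fin 9) 6 := by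
      decide
    have i3 : (swap (0 : Fin 9) 3 * swap (1 : Fin 9) 5 * swap (2 : Fin 9) 7)⁻¹ = swap (0 : Fin 9) 3 * swap (1 : Fin 9) 5 * swap (2 : Fin 9) 7 := by
      decide
    have iT : (swap (0 : Fin 6) 3 * swap (1 : Fin 6) 4 * swap (2 : Fin 6) 5)⁻¹ = swap (0 : Fin 6) 3 * swap (1 : Fin 6) 4 * swap (2 : Fin 6) 5 := by
      decide
    by_cases h0 : m = 0
    · refine ⟨π * swap (0 : Fin 6) 2, τ * (swap (0 : Fin 9) 2 * swap (3 : Fin 9) 7 * swap (4 : Fin 9) 8), ?_, ?_, ?_⟩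
      · simp only [List.map_cons, List.prod_cons, if_pos h0]
        exact rel4_mul (rel4_sigma hf le_rfl hσ) hrel
      · simp only [List.map_cons, List.prod_cons, if_pos h0]
        exact rel9_mul (rel9_sigma hU hσ) hu
      · simp only [List.map_cons, List.prod_cons, if_pos h0, hJ, mul_inv_rev, swap_inv, i1]
        rfl
    · by_cases h1 : m = 1
      · refine ⟨π * (swap (0 : Fin 6) 3 * swap (1 : Fin 6) 4 * swap (2 : Fin 6) 5),
          τ * (swap (0 : Fin 9) 8 * swap (1 : Fin 9) 7 * swap (3 : Fin 9) 6), ?_, ?_, ?_⟩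
        · simp only [List.map_cons, List.prod_cons, if_neg h0, if_pos h1]
          exact rel4_mul (rel4_psi hf le_rfl hψ) hrel
        · simp only [List.map_cons, List.prod_cons, if_neg h0, if_pos h1]
          exact rel9_mul (rel9_psi hU hψ) hu
        · simp only [List.map_cons, List.prod_cons, if_neg h0, if_pos h1, hJ, mul_inv_rev, iT, i2]
          rfl
      · refine ⟨π * swap (4 : Fin 6) 5, τ * (swap (0 : Fin 9) 3 * swap (1 : Fin 9) 5 * swap (2 : Fin 9) 7), ?_, ?_, ?_⟩
        · simp only [List.map_cons, List.prod_cons, if_neg h0, if_neg h1]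
          exact rel4_mul (rel4_phi hf le_rfl hφ) hrel
        · simp only [List.map_cons, List.prod_cons, if_neg h0, if_neg h1]
          exact rel9_mul (rel9_phi hU hφ) hu
        · simp only [List.map_cons, List.prod_cons, if_neg h0, if_neg h1, hJ, mul_inv_rev, swap_inv, i3]
          rfl

include hf hU in
/-- **Invariance of `𝒥/N` for `n = 4`.** [cite: Fischler2002Polyzetas, §3 Théorème 3.2 (« 𝒥(p)/(a₃! b₃! a₂!) si n = 4 »)]
[cite: Fischler2003RhinViola, §3.3 Théorème 5] -/
theorem invariance_four_aux (hσ : ∀ p, (gσ p).1 = sigma p.1) (hψ : ∀ p, (gψ p).1 = psi 4 p.1) (hφ : ∀ p, (gφ p).1 = phi 4 p.1)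
    {g : Perm {p : Exponents // InE 4 p}} (hg : g ∈ Subgroup.closure ({gσ, gψ, gφ} : Set (Perm {p : Exponents // InE 4 p})))
    (p : {p : Exponents // InE 4 p}) (hc : FinitenessCriterionGen 4 p.1) (hcg : FinitenessCriterionGen 4 (g p).1) :
    Jn 4 (g p).1 / (rvNormaliser 4 (g p).1 : ℝ≥0∞) = Jn 4 p.1 / (rvNormaliser 4 p.1 : ℝ≥0∞) := by
  -- the joint element of `g`
  have hex : ∃ π : Perm (Fin 6), ∃ τ : Perm (Fin 9),
      (π, τ) ∈ Subgroup.closure ({((swap (0 : Fin 6) 2, swap (0 : Fin 9) 2 * swap (3 : Fin 9) 7 * swap (4 : Fin 9) 8) :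
          Perm (Fin 6) × Perm (Fin 9)),
        (swap (0 : Fin 6) 3 * swap (1 : Fin 6) 4 * swap (2 : Fin 6) 5, swap (0 : Fin 9) 8 * swap (1 : Fin 9) 7 * swap (3 : Fin 9) 6),
        (swap (4 : Fin 6) 5, swap (0 : Fin 9) 3 * swap (1 : Fin 9) 5 * swap (2 : Fin 9) 7)} : Set (Perm (Fin 6) × Perm (Fin 9))) ∧
      ((∀ x p, f x (g p).1 = f (π x) p.1) ∧ (∀ x : Fin 6, (π x).val < 3 ↔ (x.val < 3 ↔ (π 0).val < 3)) ∧
        ∀ (p : {p : Exponents // InE 4 p}) (k : ℕ), 3 ≤ k → k ≤ 4 - 2 → (g p).1.a k = p.1.a (if 3 ≤ (π 0).val then 4 + 1 - k else k)) ∧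
      (∀ x p, U x (g p).1 = U (τ x) p.1) := by
    clear hcg
    induction hg using Subgroup.closure_induction with
    | mem x hx =>
      simp only [Set.mem_insert_iff, Set.mem_singleton_iff] at hx
      rcases hx with rfl | rfl | rfl
      · exact ⟨_, _, Subgroup.subset_closure (by simp), rel4_sigma hf le_rfl hσ, rel9_sigma hU hσ⟩
      · exact ⟨_, _, Subgroup.subset_closure (by simp), rel4_psi hf le_rfl hψ, rel9_psi hU hψ⟩
      · exact ⟨_, _, Subgroup.subset_closure (by simp), rel4_phi hf le_rfl hφ, rel9_phi hU hφ⟩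
    | one =>
      exact ⟨1, 1, Subgroup.one_mem _, ⟨fun x p => rfl, fun x => by simp, fun p k hk3 hkn => by omega⟩, fun x p => rfl⟩
    | mul x y _ _ ihx ihy =>
      obtain ⟨π, τ, hm, hr, hu⟩ := ihx
      obtain ⟨π', τ', hm', hr', hu'⟩ := ihy
      exact ⟨π' * π, τ' * τ, by simpa using Subgroup.mul_mem _ hm' hm, rel4_mul hr hr', rel9_mul hu hu'⟩
    | inv x _ ihx =>
      obtain ⟨π, τ, hm, hr, hu⟩ := ihx
      exact ⟨π⁻¹, τ⁻¹, by simpa using Subgroup.inv_mem _ hm, rel4_inv hr, rel9_inv hu⟩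
  obtain ⟨π, τ, hmem, hr, hu⟩ := hex
  -- cone and criterion at `p`
  have hI : Finset.Icc 1 4 = {1, 2, 3, 4} := by decide
  have hK : (∀ k ∈ Finset.Icc 1 4, 0 ≤ p.1.a k) ∧ 0 ≤ p.1.b 2 ∧ 0 ≤ p.1.b 4 :=
    ⟨hc.1, hc.2.1 2 (by simp [hI]), hc.2.1 4 (by simp [hI])⟩
  have hb3 : 0 ≤ p.1.b 3 := hc.2.1 3 (by simp [hI])
  -- criterion of `h p` in terms of the nine forms
  have hcrit : ∀ {h : Perm {p : Exponents // InE 4 p}} {τ' : Perm (Fin 9)},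
      h ∈ Subgroup.closure ({gσ, gψ, gφ} : Set (Perm {p : Exponents // InE 4 p})) →
      (∀ x p, U x (h p).1 = U (τ' x) p.1) →
      (FinitenessCriterionGen 4 (h p).1 ↔ (fun y => decide (U y p.1 < 0)) (τ' 5) = false) := by
    intro h τ' hh hu'
    rw [crit4_iff_of_cone (h p).2 (cone4_of_mem hσ hψ hφ hh p hK), decide_eq_false_iff_not, not_lt, ← hu' 5 p, hU]
    rfl
  -- the sign pattern
  have hs5 : (fun y => decide (U y p.1 < 0)) 5 = false := by
    simp only [decide_eq_false_iff_not, not_lt, hU]; exact hb3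
  -- routing
  have hal : (fun y => decide (U y p.1 < 0)) (((π, τ)⁻¹ : Perm (Fin 6) × Perm (Fin 9)).2.symm 5) = false := by
    have e : ((π, τ)⁻¹ : Perm (Fin 6) × Perm (Fin 9)).2.symm = τ := by rw [Prod.inv_mk]; exact Equiv.symm_symm τ
    rw [e]; exact (hcrit hg hu).1 hcg
  obtain ⟨w, hwprod, hpath⟩ := route4 (fun y => decide (U y p.1 < 0)) hs5 (forbidden_pairs hU p hK) (π, τ)⁻¹
    (Subgroup.inv_mem _ hmem) hal
  -- the group word
  obtain ⟨π', τ', hr', hu', hJ⟩ := word_rel4 hf hU hσ hψ hφ w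
  rw [hwprod, Prod.inv_mk, Prod.mk.injEq, inv_inj, inv_inj] at hJ
  obtain ⟨rfl, rfl⟩ := hJ
  have hwg : (w.map fun m => if m = 0 then gσ else if m = 1 then gψ else gφ).prod = g := by
    have hm := rel4_mul (rel4_inv hr) hr'
    rw [mul_inv_cancel] at hm
    obtain ⟨h1, -, h3⟩ := hm
    have key := eq_one_of_rel4_one hf le_rfl hσ hψ hφ (Subgroup.mul_mem _ (Subgroup.inv_mem _ hg) (word_mem w))
      (fun x p => by rw [h1 x p, Perm.one_apply]) (fun p k hk3 hkn => by omega)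
    rw [inv_mul_eq_one] at key
    exact key.symm
  -- the path
  have hpath' : ∀ k, k ≤ (w.map fun m => if m = 0 then gσ else if m = 1 then gψ else gφ).length →
      FinitenessCriterionGen 4 ((((w.map fun m => if m = 0 then gσ else if m = 1 then gψ else gφ).drop k).prod p).1) := by
    intro k hk
    rw [← List.map_drop]
    obtain ⟨πk, τk, -, huk, hJk⟩ := word_rel4 hf hU hσ hψ hφ (w.drop k)
    have hak := hpath k (by simpa using hk)
    have e : (((w.drop k).map fun m : ℕ => if m = 0 then ((swap (0 : Fin 6) 2, swap (0 : Fin 9) 2 * swap (3 : Fin 9) 7 * swap (4 : Fin 9) 8) :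
          Perm (Fin 6) × Perm (Fin 9))
        else if m = 1 then (swap (0 : Fin 6) 3 * swap (1 : Fin 6) 4 * swap (2 : Fin 6) 5,
          swap (0 : Fin 9) 8 * swap (1 : Fin 9) 7 * swap (3 : Fin 9) 6)
        else (swap (4 : Fin 6) 5, swap (0 : Fin 9) 3 * swap (1 : Fin 9) 5 * swap (2 : Fin 9) 7)).prod).2.symm = τk := by
      rw [hJk]; exact Equiv.symm_symm τk
    rw [e] at hak
    exact (hcrit (word_mem (w.drop k)) huk).2 hak
  have ht := transport (by norm_num) hσ hψ hφ (w.map fun m => if m = 0 then gσ else if m = 1 then gψ else gφ)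
    (fun g' hg' => by
      simp only [List.mem_map] at hg'
      obtain ⟨m, -, rfl⟩ := hg'
      split_ifs <;> simp) p hpath'
  rwa [hwg] at ht

end Four

/-- **Invariance of `𝒥/N` for `n = 4`** (tables introduced inside). [cite: Fischler2002Polyzetas, §3 Théorème 3.2] -/
theorem invariance_four {gσ gψ gφ : Perm {p : Exponents // InE 4 p}}
    (hσ : ∀ p, (gσ p).1 = sigma p.1) (hψ : ∀ p, (gψ p).1 = psi 4 p.1) (hφ : ∀ p, (gφ p).1 = phi 4 p.1)
    {g : Perm {p : Exponents // InE 4 p}} (hg : g ∈ Subgroup.closure ({gσ, gψ, gφ} : Set (Perm {p : Exponents // InE 4 p})))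
    (p : {p : Exponents // InE 4 p}) (hc : FinitenessCriterionGen 4 p.1) (hcg : FinitenessCriterionGen 4 (g p).1) :
    Jn 4 (g p).1 / (rvNormaliser 4 (g p).1 : ℝ≥0∞) = Jn 4 p.1 / (rvNormaliser 4 p.1 : ℝ≥0∞) := by
  obtain ⟨f, hf⟩ : ∃ f : Fin 6 → Exponents → ℤ, ∀ (x : Fin 6) (p : Exponents),
      f x p = ![p.a 1, p.a 2, p.b 2, p.a 4, p.a (4 - 1), p.c 4] x := ⟨_, fun _ _ => rfl⟩
  obtain ⟨U, hU⟩ : ∃ U : Fin 9 → Exponents → ℤ, ∀ (x : Fin 9) (p : Exponents), U x p =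
      ![-p.a 1 + p.a 3 + p.a 4, p.a 1 + p.b 2 - p.b 4, p.a 1 + p.a 2 - p.b 4, -p.a 1 + p.a 2 + p.b 3, -p.a 1 + p.a 3 + p.b 4, p.b 3,
        p.a 1 - p.a 4 + p.b 2, p.a 1 + p.a 2 - p.a 3, p.a 1 + p.a 2 - p.a 4] x := ⟨_, fun _ _ => rfl⟩
  exact invariance_four_aux hf hU hσ hψ hφ hg p hc hcg

/-- **The Rhin–Viola property for `n = 4`.** [cite: Fischler2002Polyzetas, §3 Théorème 3.2] [cite: Fischler2003RhinViola, §3.3 Théorème 5] -/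
theorem isRhinViolaGroup_four {gσ gψ gφ : Perm {p : Exponents // InE 4 p}}
    (hσ : ∀ p, (gσ p).1 = sigma p.1) (hψ : ∀ p, (gψ p).1 = psi 4 p.1) (hφ : ∀ p, (gφ p).1 = phi 4 p.1) :
    IsRhinViolaGroup (fun p : {p : Exponents // InE 4 p} => Jn 4 p.1)
      (Subgroup.closure ({gσ, gψ, gφ} : Set (Perm {p : Exponents // InE 4 p}))) := by
  intro g hg p hp hgp
  have hc : FinitenessCriterionGen 4 p.1 := (Jn_finite_iff_holds 4 p.1 (by norm_num)).1 hp
  have hcg : FinitenessCriterionGen 4 (g p).1 := (Jn_finite_iff_holds 4 (g p).1 (by norm_num)).1 hgp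
  have ht := invariance_four hσ hψ hφ hg p hc hcg
  have hN := rvNormaliser_pos 4 p.1
  have hN' := rvNormaliser_pos 4 (g p).1
  refine ⟨(rvNormaliser 4 (g p).1 : ℚ) / rvNormaliser 4 p.1, ?_⟩
  have hcast : (((rvNormaliser 4 (g p).1 : ℚ) / rvNormaliser 4 p.1 : ℚ) : ℝ) =
      (rvNormaliser 4 (g p).1 : ℝ) / (rvNormaliser 4 p.1 : ℝ) := by push_cast; rfl
  rw [hcast, ENNReal.ofReal_div_of_pos (by exact_mod_cast hN), ENNReal.ofReal_natCast, ENNReal.ofReal_natCast]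
  rw [ENNReal.div_eq_div_iff (by exact_mod_cast hN.ne') (ENNReal.natCast_ne_top _) (by exact_mod_cast hN'.ne')
    (ENNReal.natCast_ne_top _)] at ht
  calc Jn 4 (g p).1 = (rvNormaliser 4 (g p).1 : ℝ≥0∞) * Jn 4 p.1 / (rvNormaliser 4 p.1 : ℝ≥0∞) :=
        (ENNReal.eq_div_iff (by exact_mod_cast hN.ne') (ENNReal.natCast_ne_top _)).2 ht
    _ = (rvNormaliser 4 (g p).1 : ℝ≥0∞) / (rvNormaliser 4 p.1 : ℝ≥0∞) * Jn 4 p.1 := by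
        rw [mul_comm (rvNormaliser 4 (g p).1 : ℝ≥0∞), mul_div_assoc, mul_comm]

/-- **Fischler's Théorème 3.2 for `n = 4` — ALL CLAUSES.** [cite: Fischler2002Polyzetas, §3 Théorème 3.2]
[cite: Fischler2003RhinViola, §3.3 Théorème 5, §3.4 Théorème 6] -/
theorem theoreme32_four :
    ∃ σ' ψ' φ' : Equiv.Perm {p : Exponents // InE 4 p},
      (∀ p, (σ' p).1 = sigma p.1) ∧ (∀ p, (ψ' p).1 = psi 4 p.1) ∧ (∀ p, (φ' p).1 = phi 4 p.1) ∧
      IsRhinViolaGroup (fun p => Jn 4 p.1)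
        (Subgroup.closure ({σ', ψ', φ'} : Set (Equiv.Perm {p : Exponents // InE 4 p}))) ∧
      Nat.card (Subgroup.closure ({σ', ψ', φ'} : Set (Equiv.Perm {p : Exponents // InE 4 p}))) = rvGroupOrder 4 ∧
      ∀ g ∈ Subgroup.closure ({σ', ψ', φ'} : Set (Equiv.Perm {p : Exponents // InE 4 p})),
        ∀ p : {p : Exponents // InE 4 p},
          FinitenessCriterionGen 4 p.1 → FinitenessCriterionGen 4 (g p).1 →
            Jn 4 (g p).1 / (rvNormaliser 4 (g p).1 : ℝ≥0∞) = Jn 4 p.1 / (rvNormaliser 4 p.1 : ℝ≥0∞) := by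
  obtain ⟨σ', ψ', φ', hσ, hψ, hφ⟩ := exists_perms (n := 4) (by norm_num)
  exact ⟨σ', ψ', φ', hσ, hψ, hφ, isRhinViolaGroup_four hσ hψ hφ, card_closure_eq (by norm_num) hσ hψ hφ,
    fun g hg p hc hcg => invariance_four hσ hψ hφ hg p hc hcg⟩

/-- **Fischler 2002, Théorème 3.2 for every `n ≥ 2` EXCEPT `n = 3` — all four typed clauses** (`theoreme32_two`, `theoreme32_four`,
`theoreme32_of_five_le`). The case `n = 3` (group `H ⋊ 𝔖₅` of order 1920, whose ORDER is proved: `card_closure_eq_three`) is the only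
part of the named fact `theoreme32` not established: there the criterion points of an orbit are not always joined by criterion paths
(seat ct-1 g33's reconnaissance), so the Rhin–Viola and invariance clauses need an argument beyond transport.
[cite: Fischler2002Polyzetas, §3 Théorème 3.2] [cite: Fischler2003RhinViola, §3.3 Théorème 5, §3.4 Théorème 6] -/
theorem theoreme32_of_ne_three (n : ℕ) (hn : 2 ≤ n) (h3 : n ≠ 3) :
    ∃ σ' ψ' φ' : Equiv.Perm {p : Exponents // InE n p},
      (∀ p, (σ' p).1 = sigma p.1) ∧ (∀ p, (ψ' p).1 = psi n p.1) ∧ (∀ p, (φ' p).1 = phi n p.1) ∧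
      IsRhinViolaGroup (fun p => Jn n p.1)
        (Subgroup.closure ({σ', ψ', φ'} : Set (Equiv.Perm {p : Exponents // InE n p}))) ∧
      Nat.card (Subgroup.closure ({σ', ψ', φ'} : Set (Equiv.Perm {p : Exponents // InE n p}))) = rvGroupOrder n ∧
      ∀ g ∈ Subgroup.closure ({σ', ψ', φ'} : Set (Equiv.Perm {p : Exponents // InE n p})),
        ∀ p : {p : Exponents // InE n p},
          FinitenessCriterionGen n p.1 → FinitenessCriterionGen n (g p).1 →
            Jn n (g p).1 / (rvNormaliser n (g p).1 : ℝ≥0∞) = Jn n p.1 / (rvNormaliser n p.1 : ℝ≥0∞) := by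
  rcases Nat.lt_or_ge n 5 with h | h
  · interval_cases n
    · exact theoreme32_two
    · exact absurd rfl h3
    · exact theoreme32_four
  · exact theoreme32_of_five_le n h

end Theoreme32

end Literature.NumberTheory.Irrationality.Fischler2002

end
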